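/-
Copyright (c) 2026 the pub-hodgecm-mathlib formalisation cell (harness21).  Prover seat hodgecm-mathlib-K2E5-p17 (g0),
Track B «K2-LIT» ∕ h413, engine E5 «TamagawaUnitary», unit QUATERNION-DICTIONARY, socket #3: payment of
`K2E5TamagawaUnitary.QuaternionDictionary.sig_K2E5QuatSplitByL` — THE CM FIELD `L` SPLITS THE QUATERNION ALGEBRA `D_h` OF A HERMITIAN PLANE.
2026-09-03.
-/
import Literature.NumberTheory.Automorphic.QuaternionAlgebraAdelic      -- ★ `IsQuaternionAlgebra` (socket vocabulary; not used in the proof)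
import Literature.NumberTheory.Automorphic.AdelicUnitaryGroup           -- ★ `cmConjRingHom L`, `cmConjRingHom_apply`, `cmConjRingHom_algebraMap`
import HarnessLib

/-!
# K2 ∕ E5 «TamagawaUnitary», unit QUATERNION-DICTIONARY, socket #3: `L ⊗_{L⁺} D_h ≃ₐ[L] M₂(L)`

Cell `pub/hodgecm-mathlib` (D-0151), Track B (21-frontier RULING «PUSH BOTH» 2026-09-03, director req621∕req624, chair K2-lead,
SKELETON LANDED K2E5 2026-09-03T21:31:58Z), socket module
`Summits/HodgeConjecture/HodgeConjecture/Cruxes/H413/Lines/K2_E5_TamagawaUnitary_QuaternionDictionary.lean` (planner K2E5-plan (g0),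
sha16 2c64fc4f5e780004), socket **`sig_K2E5QuatSplitByL`** (:65, size M), item `stmt-HodgeConjecture-24833`, route of record
`route-HodgeConjecture-HCCMUnconditional`.

THE MATHEMATICS (Galois descent along a quadratic extension; [VignerasLNM800, Ch. I §2 Thm. 2.8 «corps neutralisants», Cor. 2.4];
[PlatonovRapinchuk1994, §2.3]).  `L` a CM field, `L⁺ = maximalRealSubfield L`, `σ = cmConjRingHom L` the complex conjugation (an
`L⁺`-algebra involution of `L` with fixed field exactly `L⁺`, Mathlib `IsCMField.complexConj_eq_self_iff`, and `σ ≠ 1`, Mathlib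
`IsCMField.complexConj_ne_one`), `h = Ha ∈ M₂(L)` hermitian (`(Ha.map σ)ᵀ = Ha`) with `det Ha ≠ 0`, and `D ⊆ M₂(L)` the `L⁺`-subalgebra with
carrier `{x | x̄ᵀ · Ha = Ha · adj x}` (`x̄ = x.map σ`).  Put `ψ x := adj (x̄ᵀ)` — a `σ`-SEMILINEAR MULTIPLICATIVE INVOLUTION of `M₂(L)` (for
`2 × 2` matrices `adj` is additive, `adj ∘ adj = id`, and `adj`, `ᵀ`, `x ↦ x̄` pairwise commute) — and
`θ x := (det Ha)⁻¹ • (adj Ha · ψ x · Ha)` (`= Ha⁻¹ ψ(x) Ha`).  Then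
* `θ` is additive, `θ (c • x) = σ c • θ x`, and `θ ∘ θ = id` (uses `ψ (adj Ha) = Ha`, `ψ Ha = adj Ha`, `σ (det Ha) = det Ha`, all from
  hermitian-ness, and `adj Ha · Ha = det Ha • 1`);
* `x ∈ D ⟺ θ x = x` (apply the anti-involution `y ↦ ȳᵀ` to the defining equation: `x̄ᵀ Ha = Ha adj x ⟺ Ha x = ψ(x) Ha`).
So `D = Fix θ` for a `σ`-semilinear involution `θ` of the `L`-space `M₂(L)`, and quadratic descent is explicit: choose `α ∈ L` with
`σ α ≠ α` and put `c := (σ α − α)⁻¹`; for `v ∈ M₂(L)` both `v + θ v` and `α v + θ(α v) = α v + σ(α) θ v` lie in `D`, and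
`v = c σ(α) · (v + θ v) − c · (α v + θ(α v))`.  Hence the `L`-algebra map `Φ : L ⊗_{L⁺} D → M₂(L)`, `l ⊗ d ↦ l d`
(`Algebra.TensorProduct.lift (Algebra.ofId L M₂(L)) D.val`) is SURJECTIVE, and the `L⁺`-additive map
`G v := (c σ α) ⊗ (v + θ v) − c ⊗ (α v + θ(α v))` is a LEFT INVERSE of `Φ` (on `l ⊗ d`: `l d + θ(l d) = (l + σ l) d` and
`α l d + θ(α l d) = (α l + σ(α l)) d` with `l + σ l, α l + σ(α l) ∈ L⁺`, so `G (l d) = (c σ α (l + σ l) − c (α l + σ α σ l)) ⊗ d = l ⊗ d`),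
so `Φ` is injective; `AlgEquiv.ofBijective Φ` is the required `L ⊗_{L⁺} D ≃ₐ[L] M₂(L)`.  No dimension count and no appeal to the sibling
socket `sig_K2E5QuatSubalgebraOfPlane` is needed: the file is self-contained over Mathlib + ★ `cmConjRingHom`.

* §1 `2 × 2` identities for `ψ x = adj (x̄ᵀ)` over any commutative ring with an endomorphism `σ` (`psi_add`, `psi_smul`, `psi_mul`,
  `psi_psi`, `conjTranspose'_mul`, `conjTranspose'_conjTranspose'`, `conjTranspose'_adjugate`, `psi_adjugate_of_hermitian`,
  `map_det_of_hermitian`) — all by `fin_cases` on entries;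
* §2 the head **`quatSplitByL`** — `sig_K2E5QuatSplitByL` TOKEN FOR TOKEN (by-name tie
  `example : type_of% @quatSplitByL = type_of% @K2E5TamagawaUnitary.QuaternionDictionary.sig_K2E5QuatSplitByL := rfl`
  checked at home against the socket module by import, see `K2/K2E5-p17/g0/Probe_K2E5QuatSplitByL_import.lean`).

HONEST LABEL.  HC_CM is proved only modulo the 7 printed citations (2 remaining named inputs: hLiu418 = `stmt-HodgeConjecture-24832`, h413 =
`stmt-HodgeConjecture-24833`) until rung 0 closes; this file is a `--supports stmt-HodgeConjecture-24833 --as helper` payment and moves no counter.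

## References
* [VignerasLNM800] M.-F. Vignéras, *Arithmétique des algèbres de quaternions*, LNM 800, Springer (1980) — Ch. I §2 Thm. 2.8 (corps
  neutralisants: a quadratic `L/K` splits `H` iff …), Cor. 2.4 (caractérisation des algèbres de matrices).
* [PlatonovRapinchuk1994] V. Platonov, A. Rapinchuk, *Algebraic Groups and Number Theory*, Academic Press (1994) — §2.3 (unitary groups of
  hermitian forms over a quadratic extension; `SU₂` of a hermitian plane as `SL₁` of a quaternion algebra).
-/

set_option autoImplicit false
-- the mandated namespace repeats the single-problem summit's segment (`HodgeConjecture.HodgeConjecture`)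
set_option linter.dupNamespace false

noncomputable section

open NumberField

namespace Summit.HodgeConjecture.HodgeConjecture.Cruxes.H413.K2E5QuatSplitByL

open Literature.NumberTheory.Automorphic
open scoped Matrix TensorProduct

/-! ## §1 `2 × 2` identities for `ψ x = adj ((x.map σ)ᵀ)` and `x ↦ (x.map σ)ᵀ` -/

section TwoByTwo

variable {R : Type*} [CommRing R] (σ : R →+* R)

/-- `ψ = adj ∘ ᵀ ∘ (map σ)` is ADDITIVE on `2 × 2` matrices (the adjugate of a `2 × 2` matrix is a linear function of its entries).
[folklore] -/
theorem psi_add (x y : Matrix (Fin 2) (Fin 2) R) :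
    Matrix.adjugate (((x + y).map σ)ᵀ) = Matrix.adjugate ((x.map σ)ᵀ) + Matrix.adjugate ((y.map σ)ᵀ) := by
  ext i j; fin_cases i <;> fin_cases j <;> simp [Matrix.adjugate_fin_two] <;> ring

/-- `ψ` is `σ`-SEMILINEAR: `ψ (c • x) = σ c • ψ x` (`2 × 2`: `adj (c • A) = c • adj A`). [folklore] -/
theorem psi_smul (c : R) (x : Matrix (Fin 2) (Fin 2) R) :
    Matrix.adjugate (((c • x).map σ)ᵀ) = σ c • Matrix.adjugate ((x.map σ)ᵀ) := by
  ext i j; fin_cases i <;> fin_cases j <;> simp [Matrix.adjugate_fin_two]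

/-- `ψ` is MULTIPLICATIVE (it is the composite of the two anti-automorphisms `adj` and `x ↦ (x.map σ)ᵀ`). [folklore] -/
theorem psi_mul (x y : Matrix (Fin 2) (Fin 2) R) :
    Matrix.adjugate (((x * y).map σ)ᵀ) = Matrix.adjugate ((x.map σ)ᵀ) * Matrix.adjugate ((y.map σ)ᵀ) := by
  ext i j; fin_cases i <;> fin_cases j <;>
    simp [Matrix.adjugate_fin_two, Matrix.mul_apply, Fin.sum_univ_two] <;> ring

/-- `ψ` is an INVOLUTION when `σ` is (`adj ∘ adj = id` on `2 × 2` matrices and `adj` commutes with `ᵀ` and `map σ`). [folklore] -/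
theorem psi_psi (hσ : ∀ a, σ (σ a) = a) (x : Matrix (Fin 2) (Fin 2) R) :
    Matrix.adjugate (((Matrix.adjugate ((x.map σ)ᵀ)).map σ)ᵀ) = x := by
  ext i j; fin_cases i <;> fin_cases j <;> simp [Matrix.adjugate_fin_two, hσ]

/-- the `σ`-conjugate transpose `x ↦ (x.map σ)ᵀ` is ANTI-MULTIPLICATIVE. [folklore] -/
theorem conjTranspose'_mul {n : Type*} [Fintype n] (x y : Matrix n n R) :
    ((x * y).map σ)ᵀ = (y.map σ)ᵀ * (x.map σ)ᵀ := by
  rw [Matrix.map_mul, Matrix.transpose_mul]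

/-- the `σ`-conjugate transpose is an INVOLUTION when `σ` is. [folklore] -/
theorem conjTranspose'_conjTranspose' {n : Type*} (hσ : ∀ a, σ (σ a) = a) (x : Matrix n n R) :
    ((((x.map σ)ᵀ).map σ)ᵀ) = x := by
  ext i j; simp [hσ]

/-- the `σ`-conjugate transpose COMMUTES with the adjugate (`2 × 2`). [folklore] -/
theorem conjTranspose'_adjugate (x : Matrix (Fin 2) (Fin 2) R) :
    ((Matrix.adjugate x).map σ)ᵀ = Matrix.adjugate ((x.map σ)ᵀ) := by
  ext i j; fin_cases i <;> fin_cases j <;> simp [Matrix.adjugate_fin_two]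

/-- for a `σ`-HERMITIAN `2 × 2` matrix `Ha` (`(Ha.map σ)ᵀ = Ha`): `ψ (adj Ha) = Ha`. [folklore] -/
theorem psi_adjugate_of_hermitian (Ha : Matrix (Fin 2) (Fin 2) R) (hHa : (Ha.map σ)ᵀ = Ha) :
    Matrix.adjugate (((Matrix.adjugate Ha).map σ)ᵀ) = Ha := by
  rw [conjTranspose'_adjugate, hHa, Matrix.adjugate_adjugate Ha (by simp)]
  simp

/-- for a `σ`-HERMITIAN matrix `Ha`: `σ (det Ha) = det Ha`. [folklore] -/
theorem map_det_of_hermitian {n : Type*} [Fintype n] [DecidableEq n] (Ha : Matrix n n R) (hHa : (Ha.map σ)ᵀ = Ha) :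
    σ Ha.det = Ha.det := by
  conv_rhs => rw [← hHa]
  rw [Matrix.det_transpose, RingHom.map_det, RingHom.mapMatrix_apply]

end TwoByTwo

/-! ## §2 The head: `L ⊗_{L⁺} D_h ≃ₐ[L] M₂(L)` by explicit quadratic Galois descent -/

/-- **PAYMENT OF `sig_K2E5QuatSplitByL`** (socket #3 of unit QUATERNION-DICTIONARY of the K2 ∕ E5 road,
`Cruxes/H413/Lines/K2_E5_TamagawaUnitary_QuaternionDictionary.lean` :65, TOKEN FOR TOKEN): for a CM field `L` with complex conjugation
`σ = cmConjRingHom L`, a hermitian `Ha ∈ M₂(L)` with `det Ha ≠ 0`, and the `L⁺`-subalgebra `D = {x | (x.map σ)ᵀ · Ha = Ha · adj x} ⊆ M₂(L)`,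
the multiplication map `L ⊗_{L⁺} D → M₂(L)`, `l ⊗ d ↦ l · d`, is an isomorphism of `L`-algebras — `L` SPLITS the quaternion algebra `D = D_h`
(`L ⊗_{L⁺} D_h ≅ M₂(L)`).  Proof: `D` is the fixed algebra of the `σ`-semilinear involution `θ x = (det Ha)⁻¹ • (adj Ha · adj((x.map σ)ᵀ) · Ha)`
of `M₂(L)`, and quadratic descent along `L/L⁺ = L^{σ}` is made explicit with any `α`, `σ α ≠ α` (surjectivity:
`v = c σ(α)(v + θ v) − c (α v + θ(α v))`, `c = (σ α − α)⁻¹`; injectivity: the same formula is an additive left inverse).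
[cite: VignerasLNM800, Ch. I §2 Thm. 2.8 (corps neutralisants); Ch. I §2 Cor. 2.4] [cite: PlatonovRapinchuk1994, §2.3] -/
theorem quatSplitByL :
    ∀ (L : Type) [Field L] [NumberField L] [IsCMField L]
      (Ha : Matrix (Fin 2) (Fin 2) L) (_ : (Ha.map (cmConjRingHom L)).transpose = Ha) (_ : Ha.det ≠ 0)
      (D : Subalgebra (↥(maximalRealSubfield L)) (Matrix (Fin 2) (Fin 2) L))
      (_ : ∀ x : Matrix (Fin 2) (Fin 2) L, x ∈ D ↔ (x.map (cmConjRingHom L))ᵀ * Ha = Ha * Matrix.adjugate x),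
      Nonempty (L ⊗[↥(maximalRealSubfield L)] ↥D ≃ₐ[L] Matrix (Fin 2) (Fin 2) L) := by
  intro L _ _ _ Ha hHa hdet D hD
  /- (0) the complex conjugation `σ`: an involution, trivial on `L⁺`, with fixed field `L⁺`, and non-trivial -/
  have hσσ : ∀ a : L, cmConjRingHom L (cmConjRingHom L a) = a := fun a => by
    simp [cmConjRingHom_apply]
  have hσK : ∀ a : ↥(maximalRealSubfield L), cmConjRingHom L (a : L) = a := fun a =>
    cmConjRingHom_algebraMap L a
  have hfix : ∀ a : L, cmConjRingHom L a = a → a ∈ maximalRealSubfield L := fun a ha => by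
    rwa [cmConjRingHom_apply, IsCMField.complexConj_eq_self_iff] at ha
  obtain ⟨α, hα⟩ : ∃ α : L, cmConjRingHom L α ≠ α := by
    by_contra h
    push Not at h
    exact IsCMField.complexConj_ne_one L (AlgEquiv.ext fun x => h x)
  have hδ : cmConjRingHom L α - α ≠ 0 := sub_ne_zero.mpr hα
  have hdetσ : cmConjRingHom L Ha.det = Ha.det := map_det_of_hermitian (cmConjRingHom L) Ha hHa
  /- (1) the descent involution `θ` -/
  obtain ⟨θ, θ_def⟩ : ∃ θ : Matrix (Fin 2) (Fin 2) L → Matrix (Fin 2) (Fin 2) L, ∀ x,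
      θ x = (Ha.det)⁻¹ • (Ha.adjugate * Matrix.adjugate ((x.map (cmConjRingHom L))ᵀ) * Ha) :=
    ⟨_, fun _ => rfl⟩
  have θ_add : ∀ x y, θ (x + y) = θ x + θ y := fun x y => by
    rw [θ_def, θ_def, θ_def, psi_add, Matrix.mul_add, Matrix.add_mul, smul_add]
  have θ_smul : ∀ (c : L) (x : Matrix (Fin 2) (Fin 2) L), θ (c • x) = cmConjRingHom L c • θ x := fun c x => by
    rw [θ_def, θ_def, psi_smul, Matrix.mul_smul, Matrix.smul_mul, smul_comm]
  have θ_θ : ∀ x, θ (θ x) = x := fun x => by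
    rw [θ_def, θ_def x, psi_smul, psi_mul, psi_mul, psi_adjugate_of_hermitian _ Ha hHa,
      psi_psi _ hσσ, hHa, map_inv₀, hdetσ, Matrix.mul_smul, Matrix.smul_mul, smul_smul]
    have key : Ha.adjugate * (Ha * x * Ha.adjugate) * Ha = (Ha.det * Ha.det) • x := by
      calc Ha.adjugate * (Ha * x * Ha.adjugate) * Ha
          = (Ha.adjugate * Ha) * x * (Ha.adjugate * Ha) := by simp only [Matrix.mul_assoc]
        _ = (Ha.det * Ha.det) • x := by
          rw [Matrix.adjugate_mul, Matrix.smul_mul, Matrix.one_mul, Matrix.mul_smul, Matrix.mul_one, smul_smul]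
    rw [key, smul_smul]
    have h1 : (Ha.det)⁻¹ * (Ha.det)⁻¹ * (Ha.det * Ha.det) = 1 := by field_simp
    rw [h1, one_smul]
  /- (2) `D = Fix θ` -/
  have mem_iff : ∀ x, x ∈ D ↔ θ x = x := fun x => by
    rw [hD, θ_def]
    -- `x̄ᵀ Ha = Ha adj x ⟺ Ha x = ψ x Ha`: apply the anti-involution `y ↦ ȳᵀ`
    have step : (x.map (cmConjRingHom L))ᵀ * Ha = Ha * Matrix.adjugate x ↔
        Ha * x = Matrix.adjugate ((x.map (cmConjRingHom L))ᵀ) * Ha := by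
      constructor
      · intro h
        have h' := congrArg (fun y : Matrix (Fin 2) (Fin 2) L => (y.map (cmConjRingHom L))ᵀ) h
        simpa only [conjTranspose'_mul, conjTranspose'_conjTranspose' _ hσσ, hHa, conjTranspose'_adjugate] using h'
      · intro h
        have h' := congrArg (fun y : Matrix (Fin 2) (Fin 2) L => (y.map (cmConjRingHom L))ᵀ) h
        simpa only [conjTranspose'_mul, conjTranspose'_conjTranspose' _ hσσ, hHa, conjTranspose'_adjugate] using h'
    rw [step]
    constructor
    · intro h
      rw [Matrix.mul_assoc, ← h, ← Matrix.mul_assoc, Matrix.adjugate_mul, Matrix.smul_mul, Matrix.one_mul, smul_smul,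
        inv_mul_cancel₀ hdet, one_smul]
    · intro h
      conv_lhs => rw [← h]
      rw [Matrix.mul_smul, Matrix.mul_assoc, ← Matrix.mul_assoc Ha, Matrix.mul_adjugate, Matrix.smul_mul, Matrix.one_mul,
        smul_smul, inv_mul_cancel₀ hdet, one_smul]
  have fix_mem : ∀ v, v + θ v ∈ D := fun v => (mem_iff _).2 (by rw [θ_add, θ_θ, add_comm])
  have θ_coe : ∀ d : ↥D, θ (d : Matrix (Fin 2) (Fin 2) L) = d := fun d => (mem_iff _).1 d.2
  /- (3) the forward `L`-algebra map `Φ : l ⊗ d ↦ l • d` -/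
  obtain ⟨Φ, Φ_tmul⟩ : ∃ Φ : L ⊗[↥(maximalRealSubfield L)] ↥D →ₐ[L] Matrix (Fin 2) (Fin 2) L,
      ∀ (l : L) (d : ↥D), Φ (l ⊗ₜ d) = l • (d : Matrix (Fin 2) (Fin 2) L) :=
    ⟨Algebra.TensorProduct.lift (Algebra.ofId L (Matrix (Fin 2) (Fin 2) L)) D.val
        (fun l d => Algebra.commutes l (d : Matrix (Fin 2) (Fin 2) L)),
      fun l d => by rw [Algebra.TensorProduct.lift_tmul, Algebra.ofId_apply, Subalgebra.coe_val, Algebra.smul_def]⟩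
  /- (4) the two `D`-valued `L⁺`-additive projections and the inverse `G` -/
  set c : L := (cmConjRingHom L α - α)⁻¹ with hc
  have hc1 : c * (cmConjRingHom L α - α) = 1 := inv_mul_cancel₀ hδ
  obtain ⟨w₁, w₁_coe⟩ : ∃ w₁ : Matrix (Fin 2) (Fin 2) L → ↥D, ∀ v, (w₁ v : Matrix (Fin 2) (Fin 2) L) = v + θ v :=
    ⟨fun v => ⟨v + θ v, fix_mem v⟩, fun _ => rfl⟩
  obtain ⟨w₂, w₂_coe⟩ : ∃ w₂ : Matrix (Fin 2) (Fin 2) L → ↥D, ∀ v, (w₂ v : Matrix (Fin 2) (Fin 2) L) = α • v + θ (α • v) :=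
    ⟨fun v => ⟨α • v + θ (α • v), fix_mem (α • v)⟩, fun _ => rfl⟩
  have w₁_add : ∀ v w, w₁ (v + w) = w₁ v + w₁ w := fun v w => by
    apply Subtype.ext
    simp only [Subalgebra.coe_add, w₁_coe, θ_add]
    abel
  have w₂_add : ∀ v w, w₂ (v + w) = w₂ v + w₂ w := fun v w => by
    apply Subtype.ext
    simp only [Subalgebra.coe_add, w₂_coe, smul_add, θ_add]
    abel
  obtain ⟨G, G_def⟩ : ∃ G : Matrix (Fin 2) (Fin 2) L → L ⊗[↥(maximalRealSubfield L)] ↥D, ∀ v,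
      G v = (c * cmConjRingHom L α) ⊗ₜ w₁ v - c ⊗ₜ w₂ v :=
    ⟨_, fun _ => rfl⟩
  have G_add : ∀ v w, G (v + w) = G v + G w := fun v w => by
    rw [G_def, G_def, G_def, w₁_add, w₂_add, TensorProduct.tmul_add, TensorProduct.tmul_add]
    abel
  /- (5) `Φ ∘ G = id`: surjectivity -/
  have ΦG : ∀ v, Φ (G v) = v := fun v => by
    rw [G_def, map_sub, Φ_tmul, Φ_tmul, w₁_coe, w₂_coe, θ_smul]
    calc (c * cmConjRingHom L α) • (v + θ v) - c • (α • v + cmConjRingHom L α • θ v)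
        = (c * (cmConjRingHom L α - α)) • v := by module
      _ = v := by rw [hc1, one_smul]
  /- (6) `G ∘ Φ = id`: injectivity -/
  have GΦ : ∀ t, G (Φ t) = t := fun t => by
    induction t using TensorProduct.induction_on with
    | zero =>
      have h0 : G 0 + G 0 = G 0 := by rw [← G_add, add_zero]
      rw [map_zero]
      exact add_eq_left.mp h0
    | add s t hs ht => rw [map_add, G_add, hs, ht]
    | tmul l d =>
      rw [Φ_tmul, G_def]
      -- the two projections of `l • d` are `L⁺`-multiples of `d`
      have e₁ : w₁ (l • (d : Matrix (Fin 2) (Fin 2) L)) =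
          (⟨l + cmConjRingHom L l, hfix _ (by rw [map_add, hσσ, add_comm])⟩ : ↥(maximalRealSubfield L)) • d := by
        apply Subtype.ext
        rw [w₁_coe, θ_smul, θ_coe, Subalgebra.coe_smul, ← algebraMap_smul L, ← add_smul]
        rfl
      have e₂ : w₂ (l • (d : Matrix (Fin 2) (Fin 2) L)) =
          (⟨α * l + cmConjRingHom L (α * l), hfix _ (by rw [map_add, hσσ, add_comm])⟩ : ↥(maximalRealSubfield L)) • d := by
        apply Subtype.ext
        rw [w₂_coe, smul_smul, θ_smul, θ_coe, Subalgebra.coe_smul, ← algebraMap_smul L, ← add_smul]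
        rfl
      rw [e₁, e₂, TensorProduct.tmul_smul, TensorProduct.tmul_smul, TensorProduct.smul_tmul', TensorProduct.smul_tmul',
        ← TensorProduct.sub_tmul]
      congr 1
      change (l + cmConjRingHom L l) * (c * cmConjRingHom L α) - (α * l + cmConjRingHom L (α * l)) * c = l
      rw [map_mul]
      linear_combination l * hc1
  exact ⟨AlgEquiv.ofBijective Φ ⟨Function.LeftInverse.injective GΦ, Function.RightInverse.surjective ΦG⟩⟩

end Summit.HodgeConjecture.HodgeConjecture.Cruxes.H413.K2E5QuatSplitByL

end
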